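import Summits.SmoothPoincare4.SmoothPoincare4.Theorems.SullivanDualWitnessChargeHelperEndHolomorphic
import Mathlib.Analysis.Complex.Liouville

/-!
# Rigidity of flat pencil members: a member inside the flat region is the far line

Crux `WitnessCharge` (item stmt-SmoothPoincare4-7824, route `SullivanDual`, crux
`Summit.SmoothPoincare4.SmoothPoincare4.Theses.SullivanDual.WitnessCharge`), line `Sketch`,
stub `helper_flatMemberIsFarLine` (W12 of the lead's cycle-2 helper skeleton).

For `J` STANDARD on the punctured chart-ball `B_{ε'}` at `p`, a pencil member `u : ℂ → Σ ∖ p` of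
intercept `b` (`IsPencilMember J u b`) whose image lies ENTIRELY in `B_{ε'}` is the far flat line
`w = b` in its canonical parametrisation: `Ycoord p (u ξ) = (ξ, b)` for every `ξ`.

Proof. By holomorphy in the flat end (`differentiableAt_Ycoord_comp`, the pointwise form of
`helper_endHolomorphic`, E0) the map `Y = Ycoord p ∘ u : ℂ → ℂ × ℂ` is complex differentiable at
every point of `u⁻¹(B_{ε'}) = ℂ`, i.e. entire. Its second component tends to `b` along
`cocompact ℂ`, and `ξ ↦ (Y ξ).1 − ξ` is entire and tends to `0`; an entire function with a finite
limit at infinity is that constant (Liouville, `Differentiable.apply_eq_of_tendsto_cocompact`).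

References: M. Gromov, *Pseudo holomorphic curves in symplectic manifolds*, Invent. Math. 82
(1985), §2.4.A [Gromov1985].
-/

noncomputable section

-- the prescribed namespace `Summit.<P>.<Sub>.…` duplicates `SmoothPoincare4` (P = Sub)
set_option linter.dupNamespace false

open scoped Manifold ContDiff Topology
open Set Filter Literature.Geometry.Kaehler Literature.Geometry.Symplectic
  Literature.Topology.FourManifolds

namespace Summit.SmoothPoincare4.SmoothPoincare4.Theorems.WitnessCharge.PencilIncompleteness

/-- **A pencil member inside the flat region is the far line (W12).** For `J` standard on the
punctured chart-ball `B_{ε'}` at `p` and a pencil member `u` of intercept `b` with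
`u ξ ∈ B_{ε'}` for all `ξ`, the complex flat coordinates of `u` are exactly `(ξ, b)`:
`Ycoord p ∘ u` is entire (E0), `(Ycoord p (u ξ)).2 → b` and `(Ycoord p (u ξ)).1 − ξ → 0` at
infinity, so both are constant by Liouville. (Line `Sketch`, `Lines/Sketch.md` (P6)(F3).) -/
theorem helper_flatMemberIsFarLine :
    ∀ (S : HomotopySphere 4) (p : S.carrier)
      (J : ∀ x : punctured p, TangentSpace (𝓡 4) x →L[ℝ] TangentSpace (𝓡 4) x) (ε' : ℝ)
      (u : ℂ → punctured p) (b : ℂ),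
      0 < ε' →
      Metric.closedBall (extChartAt (𝓡 4) p p) ε' ⊆ (extChartAt (𝓡 4) p).target →
      (∀ x : punctured p, InPuncturedChartBall p ε' x →
        ∀ (v : TangentSpace (𝓡 4) x) (b : EuclideanSpace ℝ (Fin 4)),
          inner ℝ (fderiv ℝ inversion (extChartAt (𝓡 4) p x.1 - extChartAt (𝓡 4) p p)
            (mfderiv (𝓡 4) 𝓘(ℝ, EuclideanSpace ℝ (Fin 4))
              (fun z : punctured p => extChartAt (𝓡 4) p z.1) x (J x v))) b
          = stdSymplecticForm (fderiv ℝ inversion (extChartAt (𝓡 4) p x.1 - extChartAt (𝓡 4) p p)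
            (mfderiv (𝓡 4) 𝓘(ℝ, EuclideanSpace ℝ (Fin 4))
              (fun z : punctured p => extChartAt (𝓡 4) p z.1) x v)) b) →
      IsPencilMember J u b → (∀ ξ : ℂ, InPuncturedChartBall p ε' (u ξ)) →
      ∀ ξ : ℂ, Ycoord p (u ξ) = (ξ, b) := by
  intro S p J ε' u b _hε' _hball hJstd hmem hflat ξ
  obtain ⟨hcurve, -, -, -, hlim₁, hlim₂⟩ := hmem
  -- E0: `Ycoord p ∘ u` is complex differentiable on `u⁻¹(B_{ε'}) = ℂ`, i.e. entire
  have hY : Differentiable ℂ (fun ξ : ℂ => Ycoord p (u ξ)) := fun ξ =>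
    differentiableAt_Ycoord_comp J hJstd hcurve.contMDiff hcurve.isJHolomorphic (hflat ξ)
  -- the two entire scalar functions with finite limits at infinity
  have h₁ : Differentiable ℂ (fun ξ : ℂ => (Ycoord p (u ξ)).1 - ξ) :=
    hY.fst.sub differentiable_fun_id
  have h₂ : Differentiable ℂ (fun ξ : ℂ => (Ycoord p (u ξ)).2) := hY.snd
  -- Liouville with a limit along `cocompact ℂ`
  have e₁ : (Ycoord p (u ξ)).1 - ξ = 0 := h₁.apply_eq_of_tendsto_cocompact ξ hlim₁
  have e₂ : (Ycoord p (u ξ)).2 = b := h₂.apply_eq_of_tendsto_cocompact ξ hlim₂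
  exact Prod.ext (sub_eq_zero.1 e₁) e₂

end Summit.SmoothPoincare4.SmoothPoincare4.Theorems.WitnessCharge.PencilIncompleteness
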